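import Literature.NumberTheory.LFunctions.DworkRationalityMeromorphy
import HarnessLib

/-!
# `p`-adic meromorphy of Dwork's torus zeta function: assembly, part 1 (Koblitz, Ch. V §4, p. 133)

Part of the bottom-up proof of Dwork's rationality theorem
(`Literature/NumberTheory/LFunctions/DworkRationality.lean`). Together with its continuation
`…/DworkRationalityMeromorphyAssembly.lean` this file **proves**

> `Literature.NumberTheory.LFunctions.Dwork.torusZeta_isMeromorphic_of :
>    dworkLifting → dworkFredholm → torusZeta_isMeromorphic`,

i.e. it carries out the end of Koblitz's Ch. V §4 given the two analytic inputs vendored in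
`…/DworkRationalityMeromorphy.lean`: the lifting of the character sum through Dwork's splitting
function (`dworkLifting`, Koblitz V.2 and V.4 pp. 132–133) and the Fredholm determinant of Dwork's
operator (`dworkFredholm`, Koblitz V.3 Lemmas 3–4). This file contains the algebra of `p`-adic
entire series (`IsEntire.mul`, `.pow`, `.prod`, `.rescale`, polynomials), the calculus of
`exp(L)` over a `ℚ`-algebra (coefficient formula, change of rings, rescaling, multiples,
`exp(-∑ aˢTˢ/s) = 1 - aT`), and steps 1–2 below (`card_pow_mul_torusCount_eq`); step 3 and the
assembly are in the continuation file.

## Proof (Koblitz, Ch. V §4, pp. 133–134)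

Fix `s ≥ 1`, `𝔽 = 𝔽_{qˢ} ⊆ k̄` (`Dwork.fixedField k s`), `n = #σ`.
1. *Orthogonality*: `∑_{x₀ ∈ 𝔽^×} ψ(x₀ u) = qˢ·[u = 0] - 1`, so
   `∑_{x ∈ (𝔽^×)^{n+1}} ψ(x₀ f(x)) = qˢ N'_s - (qˢ - 1)ⁿ` (`sum_character_eq`), `N'_s = torusCount k f s`
   being the number of zeros of `f` in `(𝔽^×)ⁿ` (`torusCount_eq_card_units`).
2. *Lifting*: by `dworkLifting` the left-hand side is `∑_{t ∈ μ_{qˢ-1}^{n+1}} ∏_{l<s} G(t^{qˡ})`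
   (reindex along the Teichmüller bijection `𝔽^× ≃ μ_{qˢ-1}(ℂ_p)`, `unitsEquivRootsOfUnity`), which
   is `(qˢ-1)^{n+1} Tr(Ψˢ)` by definition of `Dwork.traceNumber`. Hence (p. 133, last display)
   `N'_s = ∑_{i=0}^{n} (-1)ⁱ C(n,i) q^{s(n-i-1)} + ∑_{i=0}^{n+1} (-1)ⁱ C(n+1,i) q^{s(n-i)} Tr(Ψˢ)`
   (`torusCount_eq_binomial_sum`).
3. *Exponentiate* (p. 134): with `exp(-∑ (aT)ˢ/s) = 1 - aT` and
   `exp(-∑ cˢ Tr(Ψˢ) Tˢ/s) = Δ(cT)` (`dworkFredholm`), splitting the binomial sums according to the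
   parity of `i` writes `log Z' = P - N` with `exp(-P) = B`, `exp(-N) = A` finite products of
   natural powers of polynomials `1 - aT` and of rescaled Fredholm determinants `Δ(cT)`, all
   `p`-adic entire; thus `Z' · B = exp(P - N) exp(-P) = exp(-N) = A`.

## References

* N. Koblitz, *p-adic Numbers, p-adic Analysis, and Zeta-Functions*, 2nd ed., GTM 58 (1984),
  Ch. V §4, pp. 131–134. [Koblitz1984]
* B. Dwork, *On the rationality of the zeta function of an algebraic variety*, Amer. J. Math. 82
  (1960), 631–648. [Dwork1960]
-/

open PowerSeries Filter Finset

noncomputable section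

universe u

namespace Literature.NumberTheory.LFunctions

namespace Dwork

/-! ### Algebra of `p`-adic entire power series -/

section Entire

variable {p : ℕ} [Fact p.Prime]

/-- A series with eventually vanishing weighted coefficients is entire; in particular
polynomials are entire. [folklore] -/
theorem isEntire_of_coeff_eq_zero {F : ℂ_[p]⟦X⟧} {N : ℕ} (h : ∀ n, N ≤ n → coeff n F = 0) :
    IsEntire p F := by
  intro r _
  apply tendsto_const_nhds.congr'
  rw [EventuallyEq, eventually_atTop]
  exact ⟨N, fun n hn => by rw [h n hn, norm_zero, zero_mul]⟩

/-- Polynomials are `p`-adic entire. [folklore] -/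
theorem isEntire_polynomial (P : Polynomial ℂ_[p]) : IsEntire p (P : ℂ_[p]⟦X⟧) :=
  isEntire_of_coeff_eq_zero (N := P.natDegree + 1) fun n hn => by
    rw [Polynomial.coeff_coe]; exact Polynomial.coeff_eq_zero_of_natDegree_lt (by omega)

/-- `1` is entire. [folklore] -/
theorem isEntire_one : IsEntire p (1 : ℂ_[p]⟦X⟧) := by
  simpa using isEntire_polynomial (p := p) 1

/-- `1 - aT` is entire. [folklore] -/
theorem isEntire_one_sub_C_mul_X (a : ℂ_[p]) : IsEntire p (1 - C a * X : ℂ_[p]⟦X⟧) := by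
  have := isEntire_polynomial (p := p) (1 - Polynomial.C a * Polynomial.X)
  rwa [Polynomial.coe_sub, Polynomial.coe_one, Polynomial.coe_mul, Polynomial.coe_C,
    Polynomial.coe_X] at this

/-- An entire series has bounded weighted coefficients `‖a_n‖ rⁿ ≤ M`. [folklore] -/
theorem IsEntire.exists_bound {F : ℂ_[p]⟦X⟧} (hF : IsEntire p F) {r : ℝ} (hr : 0 < r) :
    ∃ M, 0 ≤ M ∧ ∀ n, ‖coeff n F‖ * r ^ n ≤ M := by
  obtain ⟨M, hM⟩ := (hF r hr).bddAbove_range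
  exact ⟨max M 0, le_max_right _ _, fun n => (hM ⟨n, rfl⟩).trans (le_max_left _ _)⟩

/-- **Products of entire series are entire** (ultrametric Cauchy product estimate:
`‖∑_{i+j=n} a_i b_j‖ rⁿ ≤ max_{i+j=n} (‖a_i‖ rⁱ)(‖b_j‖ rʲ)`, and one of `i, j` is `≥ n/2`). [folklore] -/
theorem IsEntire.mul {F G : ℂ_[p]⟦X⟧} (hF : IsEntire p F) (hG : IsEntire p G) :
    IsEntire p (F * G) := by
  intro r hr
  obtain ⟨MF, hMF0, hMF⟩ := hF.exists_bound hr
  obtain ⟨MG, hMG0, hMG⟩ := hG.exists_bound hr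
  rw [Metric.tendsto_atTop]
  intro ε hε
  -- tails of `F` and `G`
  have hε' : 0 < ε / (MF + MG + 1) := div_pos hε (by linarith)
  obtain ⟨NF, hNF⟩ := Metric.tendsto_atTop.mp (hF r hr) _ hε'
  obtain ⟨NG, hNG⟩ := Metric.tendsto_atTop.mp (hG r hr) _ hε'
  refine ⟨NF + NG, fun n hn => ?_⟩
  rw [Real.dist_eq, sub_zero, abs_of_nonneg (by positivity), coeff_mul]
  -- each term is `< ε`
  have hterm : ∀ ij ∈ antidiagonal n,
      ‖coeff ij.1 F * coeff ij.2 G‖ * r ^ n < ε := by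
    intro ij hij
    rw [mem_antidiagonal] at hij
    rw [norm_mul, ← hij, pow_add, mul_mul_mul_comm]
    rcases le_or_gt NF ij.1 with h1 | h1
    · have hF' := hNF ij.1 h1
      rw [Real.dist_eq, sub_zero, abs_of_nonneg (by positivity)] at hF'
      calc ‖coeff ij.1 F‖ * r ^ ij.1 * (‖coeff ij.2 G‖ * r ^ ij.2)
          ≤ ε / (MF + MG + 1) * MG :=
            mul_le_mul hF'.le (hMG _) (by positivity) hε'.le
        _ < ε := by
            rw [div_mul_eq_mul_div, div_lt_iff₀ (by linarith)]
            nlinarith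
    · have h2 : NG ≤ ij.2 := by omega
      have hG' := hNG ij.2 h2
      rw [Real.dist_eq, sub_zero, abs_of_nonneg (by positivity)] at hG'
      calc ‖coeff ij.1 F‖ * r ^ ij.1 * (‖coeff ij.2 G‖ * r ^ ij.2)
          ≤ MF * (ε / (MF + MG + 1)) :=
            mul_le_mul (hMF _) hG'.le (by positivity) hMF0
        _ < ε := by
            rw [mul_div_assoc', div_lt_iff₀ (by linarith)]
            nlinarith
  -- ultrametric: the norm of the sum is at most the max of the norms
  have hne : (antidiagonal n).Nonempty := ⟨(0, n), by simp⟩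
  obtain ⟨ij, hij, hmax⟩ := Finset.exists_max_image (antidiagonal n)
    (fun ij => ‖coeff ij.1 F * coeff ij.2 G‖ * r ^ n) hne
  have hle : ∀ kl ∈ antidiagonal n, ‖coeff kl.1 F * coeff kl.2 G‖ ≤ ‖coeff ij.1 F * coeff ij.2 G‖ :=
    fun kl hkl => le_of_mul_le_mul_right (hmax kl hkl) (pow_pos hr n)
  calc ‖∑ ij ∈ antidiagonal n, coeff ij.1 F * coeff ij.2 G‖ * r ^ n
      ≤ ‖coeff ij.1 F * coeff ij.2 G‖ * r ^ n :=
        mul_le_mul_of_nonneg_right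
          (IsUltrametricDist.norm_sum_le_of_forall_le_of_nonneg (norm_nonneg _) hle) (by positivity)
    _ < ε := hterm ij hij

/-- Powers of entire series are entire. [folklore] -/
theorem IsEntire.pow {F : ℂ_[p]⟦X⟧} (hF : IsEntire p F) (m : ℕ) : IsEntire p (F ^ m) := by
  induction m with
  | zero => rw [pow_zero]; exact isEntire_one
  | succ m ih => rw [pow_succ]; exact ih.mul hF

/-- Finite products of entire series are entire. [folklore] -/
theorem IsEntire.prod {ι : Type*} (t : Finset ι) {F : ι → ℂ_[p]⟦X⟧} (hF : ∀ i ∈ t, IsEntire p (F i)) :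
    IsEntire p (∏ i ∈ t, F i) := by
  classical
  induction t using Finset.induction_on with
  | empty => rw [prod_empty]; exact isEntire_one
  | insert i t hi ih =>
    rw [prod_insert hi]
    exact (hF i (mem_insert_self i t)).mul (ih fun j hj => hF j (mem_insert_of_mem hj))

/-- Rescalings `F(cT)` of entire series are entire. [folklore] -/
theorem IsEntire.rescale {F : ℂ_[p]⟦X⟧} (hF : IsEntire p F) (c : ℂ_[p]) :
    IsEntire p (rescale c F) := by
  intro r hr
  by_cases hc : c = 0
  · subst hc
    apply tendsto_const_nhds.congr'
    rw [EventuallyEq, eventually_atTop]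
    refine ⟨1, fun n hn => ?_⟩
    rw [coeff_rescale, zero_pow (by omega), zero_mul, norm_zero, zero_mul]
  · have := hF (‖c‖ * r) (mul_pos (norm_pos_iff.mpr hc) hr)
    refine this.congr fun n => ?_
    rw [coeff_rescale, norm_mul, norm_pow, mul_pow]; ring

end Entire

/-! ### Exponentials over a `ℚ`-algebra: coefficients, change of rings, rescaling, multiples -/

section Exp

variable {R : Type*} [CommRing R] [Algebra ℚ R]

/-- `[Tᵐ] exp(L) = ∑_{d ≤ m} [Tᵐ] Lᵈ / d!` for `L` without constant term, over any `ℚ`-algebra. [folklore] -/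
theorem coeff_exp_subst_eq_sum' {L : R⟦X⟧} (hL : constantCoeff L = 0) (m : ℕ) :
    coeff m ((exp R).subst L) =
      ∑ d ∈ range (m + 1), algebraMap ℚ R (1 / (d.factorial : ℚ)) * coeff m (L ^ d) := by
  rw [coeff_subst' (HasSubst.of_constantCoeff_zero' hL)]
  rw [finsum_eq_sum_of_support_subset _ (s := range (m + 1))]
  · refine Finset.sum_congr rfl fun d _ => ?_
    rw [coeff_exp, smul_eq_mul]
  · intro d hd
    rw [Function.mem_support] at hd
    rw [coe_range, Set.mem_Iio]
    by_contra h
    push Not at h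
    apply hd
    rw [coeff_of_lt_order m, smul_zero]
    exact lt_of_lt_of_le (by exact_mod_cast h) (le_order_pow_of_constantCoeff_eq_zero d hL)

/-- **Change of rings**: `φ(exp(L)) = exp(φ(L))` for a `ℚ`-algebra map, coefficientwise. [folklore] -/
theorem map_exp_subst {S : Type*} [CommRing S] [Algebra ℚ S] (φ : R →+* S)
    (hφ : ∀ x : ℚ, φ (algebraMap ℚ R x) = algebraMap ℚ S x) {L : R⟦X⟧}
    (hL : constantCoeff L = 0) :
    PowerSeries.map φ ((exp R).subst L) = (exp S).subst (PowerSeries.map φ L) := by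
  have hL' : constantCoeff (PowerSeries.map φ L) = 0 := by
    rw [← coeff_zero_eq_constantCoeff_apply, coeff_map, coeff_zero_eq_constantCoeff_apply, hL,
      map_zero]
  ext m
  rw [coeff_map, coeff_exp_subst_eq_sum' hL, coeff_exp_subst_eq_sum' hL', map_sum]
  refine Finset.sum_congr rfl fun d _ => ?_
  rw [map_mul, hφ, ← map_pow, coeff_map]

/-- **Rescaling**: `exp(L)(cT) = exp(L(cT))`. [folklore] -/
theorem rescale_exp_subst (c : R) {L : R⟦X⟧} (hL : constantCoeff L = 0) :
    rescale c ((exp R).subst L) = (exp R).subst (rescale c L) := by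
  have hL' : constantCoeff (rescale c L) = 0 := by
    rw [← coeff_zero_eq_constantCoeff_apply, coeff_rescale, coeff_zero_eq_constantCoeff_apply, hL,
      mul_zero]
  ext m
  rw [coeff_rescale, coeff_exp_subst_eq_sum' hL, coeff_exp_subst_eq_sum' hL', Finset.mul_sum]
  refine Finset.sum_congr rfl fun d _ => ?_
  rw [← map_pow, coeff_rescale]; ring

/-- `exp(m • L) = exp(L)ᵐ`. [folklore] -/
theorem exp_subst_nsmul {L : R⟦X⟧} (hL : constantCoeff L = 0) (m : ℕ) :
    (exp R).subst (m • L) = ((exp R).subst L) ^ m := by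
  induction m with
  | zero => rw [zero_nsmul, pow_zero]; exact Literature.AlgebraicGeometry.Motives.FrobeniusTrace.exp_subst_zero
  | succ m ih =>
    rw [succ_nsmul, pow_succ, Literature.AlgebraicGeometry.Motives.FrobeniusTrace.exp_subst_add _ hL, ih]
    rw [← coeff_zero_eq_constantCoeff_apply, map_nsmul, coeff_zero_eq_constantCoeff_apply, hL,
      nsmul_zero]

/-- `exp(∑ᵢ mᵢ • Lᵢ) = ∏ᵢ exp(Lᵢ)^{mᵢ}`. [folklore] -/
theorem exp_subst_sum_nsmul {ι : Type*} (t : Finset ι) (m : ι → ℕ) (L : ι → R⟦X⟧)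
    (hL : ∀ i ∈ t, constantCoeff (L i) = 0) :
    (exp R).subst (∑ i ∈ t, m i • L i) = ∏ i ∈ t, ((exp R).subst (L i)) ^ m i := by
  refine (Literature.AlgebraicGeometry.Motives.FrobeniusTrace.exp_subst_sum t (fun i => m i • L i)
    fun i hi => ?_).trans ?_
  · rw [← coeff_zero_eq_constantCoeff_apply, map_nsmul, coeff_zero_eq_constantCoeff_apply, hL i hi,
      nsmul_zero]
  · exact Finset.prod_congr rfl fun i hi => exp_subst_nsmul (hL i hi) (m i)

/-- If `Δ · exp(L) = 1` then `exp(-L) = Δ`. [folklore] -/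
theorem exp_subst_neg_eq_of_mul {Δ L : R⟦X⟧} (hL : constantCoeff L = 0) (h : Δ * (exp R).subst L = 1) :
    (exp R).subst (-L) = Δ := by
  calc (exp R).subst (-L) = Δ * ((exp R).subst L * (exp R).subst (-L)) := by
        rw [← mul_assoc, h, one_mul]
    _ = Δ := by rw [Literature.AlgebraicGeometry.Motives.FrobeniusTrace.exp_subst_mul_exp_subst_neg hL, mul_one]

/-- The logarithmic series `L_a = ∑_{s ≥ 1} aˢ Tˢ / s` of the geometric sequence. [folklore] -/
def logGeom (a : R) : R⟦X⟧ :=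
  PowerSeries.mk fun s => if s = 0 then 0 else algebraMap ℚ R (s : ℚ)⁻¹ * a ^ s

/-- Coefficients of `L_a`. [folklore] -/
@[simp] theorem coeff_logGeom (a : R) (s : ℕ) :
    coeff s (logGeom a) = if s = 0 then 0 else algebraMap ℚ R (s : ℚ)⁻¹ * a ^ s := coeff_mk _ _

/-- `L_a` has no constant term. [folklore] -/
theorem constantCoeff_logGeom (a : R) : constantCoeff (logGeom a) = 0 := by
  rw [← coeff_zero_eq_constantCoeff_apply, coeff_logGeom, if_pos rfl]

/-- `exp(∑_{s ≥ 1} aˢTˢ/s) · (1 - aT) = 1` over any `ℚ`-algebra (the `1 × 1` case of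
`Literature.AlgebraicGeometry.Motives.FrobeniusTrace.exp_subst_traceLogSeries_mul_charpolyRev`;
Koblitz, Ch. V §1: `exp(-log(1 - aT)) = 1/(1 - aT)`). [cite: Koblitz1984, Ch. V §1 Lemma 2] -/
theorem exp_subst_logGeom_mul (a : R) : (exp R).subst (logGeom a) * (1 - C a * X) = 1 := by
  have h := Literature.AlgebraicGeometry.Motives.FrobeniusTrace.exp_subst_traceLogSeries_mul_charpolyRev
    (Matrix.of fun (_ _ : Unit) => a)
  have hpow : ∀ m : ℕ, (Matrix.of fun (_ _ : Unit) => a) ^ m = Matrix.of fun (_ _ : Unit) => a ^ m := by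
    intro m
    induction m with
    | zero => ext i j; simp
    | succ n ih => rw [pow_succ, ih]; ext i j; simp [Matrix.mul_apply, pow_succ]
  have h1 : (PowerSeries.mk fun m => (m : ℚ)⁻¹ • ((Matrix.of fun (_ _ : Unit) => a) ^ m).trace) =
      logGeom a := by
    ext m
    rw [coeff_mk, coeff_logGeom, hpow, Matrix.trace, Fintype.sum_unique, Matrix.diag_apply,
      Matrix.of_apply]
    split_ifs with hm
    · simp [hm]
    · rw [Algebra.smul_def]
  have h2 : (Matrix.of fun (_ _ : Unit) => a).charpolyRev = 1 - Polynomial.C a * Polynomial.X := by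
    rw [Matrix.charpolyRev, Matrix.det_unique, Matrix.sub_apply, Matrix.one_apply_eq,
      Matrix.smul_apply, Matrix.map_apply, Matrix.of_apply, smul_eq_mul, mul_comm]
  rw [h1, h2, Polynomial.coe_sub, Polynomial.coe_one, Polynomial.coe_mul, Polynomial.coe_C,
    Polynomial.coe_X] at h
  exact h

/-- `exp(-∑_{s ≥ 1} aˢTˢ/s) = 1 - aT`. [folklore] -/
theorem exp_subst_neg_logGeom (a : R) : (exp R).subst (-logGeom a) = 1 - C a * X :=
  exp_subst_neg_eq_of_mul (constantCoeff_logGeom a) (by rw [mul_comm]; exact exp_subst_logGeom_mul a)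

end Exp


/-! ### Steps 1–2: the character sum over `(𝔽_{qˢ}^×)^{n+1}` (Koblitz, Ch. V §4, p. 133) -/

section Counting

variable {k : Type u} [Field k] [Finite k] {σ : Type} [Fintype σ] (f : MvPolynomial σ k)
variable (s : ℕ) [NeZero s]

/-- The zeros of `f` in the torus `(𝔽_{qˢ}^×)^σ`, counted inside `𝔽_{qˢ} = fixedField k s`, are
the points counted by `N'_s = torusCount k f s` (which counts them inside `k̄`). [folklore] -/
def unitsZerosEquiv :
    {x : σ → (fixedField k s)ˣ //
        MvPolynomial.aeval (fun j => ((x j : (fixedField k s)ˣ) : fixedField k s)) f = 0} ≃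
      {x : σ → AlgebraicClosure k // (IsFixedVec k s x ∧ ∀ i, x i ≠ 0) ∧
        MvPolynomial.aeval x f = 0} where
  toFun x := ⟨fun j => (((x.1 j : (fixedField k s)ˣ) : fixedField k s) : AlgebraicClosure k), by
    refine ⟨⟨fun j => ((x.1 j : (fixedField k s)ˣ) : fixedField k s).2, fun j h => ?_⟩, ?_⟩
    · exact (x.1 j).ne_zero (Subtype.ext h)
    · have h := congrArg (IsScalarTower.toAlgHom k (fixedField k s) (AlgebraicClosure k)) x.2
      rw [MvPolynomial.comp_aeval_apply, map_zero] at h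
      exact h⟩
  invFun x := ⟨fun j => Units.mk0 ⟨x.1 j, mem_fixedField.mpr (x.2.1.1 j)⟩
      (fun h => x.2.1.2 j (congrArg Subtype.val h)), by
    apply Subtype.ext
    have h := MvPolynomial.comp_aeval_apply
      (fun j => ((Units.mk0 (⟨x.1 j, mem_fixedField.mpr (x.2.1.1 j)⟩ : fixedField k s)
        (fun h => x.2.1.2 j (congrArg Subtype.val h)) : (fixedField k s)ˣ) : fixedField k s))
      (IsScalarTower.toAlgHom k (fixedField k s) (AlgebraicClosure k)) f
    rw [IsScalarTower.coe_toAlgHom'] at h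
    change algebraMap (fixedField k s) (AlgebraicClosure k) _ = ((0 : fixedField k s) : AlgebraicClosure k)
    rw [h, ZeroMemClass.coe_zero]
    exact x.2.2⟩
  left_inv x := by
    apply Subtype.ext
    funext j
    exact Units.ext (Subtype.ext rfl)
  right_inv x := rfl

open Classical in
/-- `N'_s = #{x ∈ (𝔽_{qˢ}^×)^σ | f(x) = 0}`. [cite: Koblitz1984, Ch. V §4] -/
theorem torusCount_eq_card_units :
    torusCount k f s = Fintype.card {x : σ → (fixedField k s)ˣ //
        MvPolynomial.aeval (fun j => ((x j : (fixedField k s)ˣ) : fixedField k s)) f = 0} := by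
  rw [torusCount, ← Nat.card_eq_fintype_card]
  exact (Nat.card_congr (unitsZerosEquiv f s)).symm

variable {p : ℕ} [Fact p.Prime]

open Classical in
/-- **Orthogonality over `𝔽^×`** (Koblitz, Ch. V §4, p. 133, second display:
`∑_{x₀ ∈ 𝔽_{qˢ}^×} ε^{Tr(x₀u)} = -1` if `u ≠ 0`, `qˢ - 1` if `u = 0`). [cite: Koblitz1984, Ch. V §4] -/
theorem sum_units_character (ψ : AddChar (fixedField k s) ℂ_[p])
    (hψ : ∀ u : fixedField k s, u ≠ 0 → ∑ x : fixedField k s, ψ (x * u) = 0)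
    (u : fixedField k s) :
    ∑ x : (fixedField k s)ˣ, ψ ((x : fixedField k s) * u) =
      (if u = 0 then ((Nat.card k ^ s : ℕ) : ℂ_[p]) else 0) - 1 := by
  -- `∑_{x ∈ 𝔽} = ∑_{x ≠ 0} + (x = 0 term)`
  have hsplit := Fintype.sum_subtype_add_sum_subtype (fun x : fixedField k s => x ≠ 0)
    (fun x => ψ (x * u))
  have hunits : ∑ x : (fixedField k s)ˣ, ψ ((x : fixedField k s) * u) =
      ∑ x : {x : fixedField k s // x ≠ 0}, ψ ((x : fixedField k s) * u) :=
    Fintype.sum_equiv unitsEquivNeZero _ _ fun x => rfl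
  have hzero : ∑ x : {x : fixedField k s // ¬x ≠ 0}, ψ ((x : fixedField k s) * u) = 1 := by
    haveI : Unique {x : fixedField k s // ¬x ≠ 0} :=
      ⟨⟨⟨0, fun h => h rfl⟩⟩, fun x => Subtype.ext (not_not.mp x.2)⟩
    rw [Fintype.sum_unique, show ((default : {x : fixedField k s // ¬x ≠ 0}) : fixedField k s) = 0
      from not_not.mp (default : {x : fixedField k s // ¬x ≠ 0}).2, zero_mul,
      AddChar.map_zero_eq_one]
  have htotal : ∑ x : fixedField k s, ψ (x * u) =
      if u = 0 then ((Nat.card k ^ s : ℕ) : ℂ_[p]) else 0 := by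
    split_ifs with hu
    · simp only [hu, mul_zero, AddChar.map_zero_eq_one, Finset.sum_const, Finset.card_univ,
        nsmul_eq_mul, mul_one, card_fixedField, Nat.cast_pow]
    · exact hψ u hu
  rw [hunits, ← htotal, ← hsplit, hzero, add_sub_cancel_right]

open Classical in
/-- **The character sum** (Koblitz, Ch. V §4, p. 133, third display):
`∑_{x₀, x₁, …, x_n ∈ 𝔽_{qˢ}^×} ε^{Tr(x₀ f(x₁, …, x_n))} = qˢ N'_s - (qˢ - 1)ⁿ`. [cite: Koblitz1984, Ch. V §4] -/
theorem sum_character_eq (ψ : AddChar (fixedField k s) ℂ_[p])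
    (hψ : ∀ u : fixedField k s, u ≠ 0 → ∑ x : fixedField k s, ψ (x * u) = 0) :
    ∑ x : Option σ → (fixedField k s)ˣ,
        ψ (((x none : (fixedField k s)ˣ) : fixedField k s) *
          MvPolynomial.aeval (fun j => ((x (some j) : (fixedField k s)ˣ) : fixedField k s)) f) =
      ((Nat.card k ^ s : ℕ) : ℂ_[p]) * torusCount k f s -
        ((Nat.card k ^ s - 1 : ℕ) : ℂ_[p]) ^ Fintype.card σ := by
  -- split off the coordinate `x₀` and sum over it first
  have hsplit : ∑ x : Option σ → (fixedField k s)ˣ,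
      ψ (((x none : (fixedField k s)ˣ) : fixedField k s) *
        MvPolynomial.aeval (fun j => ((x (some j) : (fixedField k s)ˣ) : fixedField k s)) f) =
      ∑ y : (fixedField k s)ˣ × (σ → (fixedField k s)ˣ), ψ (((y.1 : (fixedField k s)ˣ) : fixedField k s) *
        MvPolynomial.aeval (fun j => ((y.2 j : (fixedField k s)ˣ) : fixedField k s)) f) :=
    Fintype.sum_equiv (Equiv.piOptionEquivProd (β := fun _ : Option σ => (fixedField k s)ˣ)) _ _
      fun x => rfl
  rw [hsplit, Fintype.sum_prod_type, Finset.sum_comm]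
  simp_rw [sum_units_character s ψ hψ]
  rw [Finset.sum_sub_distrib, Finset.sum_ite, Finset.sum_const_zero, add_zero]
  simp only [Finset.sum_const, Finset.card_univ, nsmul_eq_mul, mul_one, Fintype.card_fun,
    Fintype.card_units, card_fixedField]
  rw [torusCount_eq_card_units f s, Fintype.card_subtype]
  push_cast
  ring

variable (p) in
open Classical in
/-- **Lifting the character sum** (Koblitz, Ch. V §4, p. 133, fourth and fifth displays): with the
data of `dworkLifting` at level `s`, `qˢ N'_s = (qˢ - 1)ⁿ + ∑_{x ∈ μ_{qˢ-1}^{n+1}} G(x) G(x^q) ⋯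
G(x^{q^{s-1}}) = (qˢ - 1)ⁿ + (qˢ - 1)^{n+1} Tr(Ψˢ)`. [cite: Koblitz1984, Ch. V §4] -/
theorem card_pow_mul_torusCount_eq (G : MvPowerSeries (Option σ) ℂ_[p])
    (τ : fixedField k s →*₀ ℂ_[p]) (ψ : AddChar (fixedField k s) ℂ_[p])
    (hτ : Function.Injective τ)
    (hτpow : ∀ x : fixedField k s, x ≠ 0 → τ x ^ (Nat.card k ^ s - 1) = 1)
    (hτsurj : ∀ y : ℂ_[p], y ^ (Nat.card k ^ s - 1) = 1 → ∃ x : fixedField k s, τ x = y)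
    (hψ : ∀ u : fixedField k s, u ≠ 0 → ∑ x : fixedField k s, ψ (x * u) = 0)
    (hid : ∀ x : Option σ → fixedField k s, (∀ i, x i ≠ 0) →
      ∏ l ∈ Finset.range s, evalAt p G (fun i => τ (x i) ^ (Nat.card k ^ l)) =
        ψ (x none * MvPolynomial.aeval (fun j => x (some j)) f)) :
    ((Nat.card k ^ s : ℕ) : ℂ_[p]) * torusCount k f s =
      ((Nat.card k ^ s - 1 : ℕ) : ℂ_[p]) ^ Fintype.card σ +
        ((Nat.card k ^ s - 1 : ℕ) : ℂ_[p]) ^ (Fintype.card σ + 1) *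
          traceNumber p (Nat.card k) G s := by
  haveI : NeZero (Nat.card k ^ s - 1) := ⟨by
    have : 2 ≤ Nat.card k ^ s := le_trans one_lt_natCard (Nat.le_self_pow (NeZero.ne s) _)
    omega⟩
  haveI : Fintype (Option σ → rootsOfUnity (Nat.card k ^ s - 1) ℂ_[p]) := Fintype.ofFinite _
  -- the Teichmüller bijection `𝔽^× ≃ μ_{qˢ-1}`
  let e₀ : (fixedField k s)ˣ → rootsOfUnity (Nat.card k ^ s - 1) ℂ_[p] := fun x =>
    rootsOfUnity.mkOfPowEq (τ (x : fixedField k s)) (hτpow _ x.ne_zero)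
  have he₀ : ∀ x : (fixedField k s)ˣ, ((e₀ x : ℂ_[p]ˣ) : ℂ_[p]) = τ (x : fixedField k s) :=
    fun x => rootsOfUnity.coe_mkOfPowEq _
  have hbij : Function.Bijective e₀ := by
    constructor
    · intro x y h
      have h' : τ (x : fixedField k s) = τ (y : fixedField k s) := by rw [← he₀, ← he₀, h]
      exact Units.ext (hτ h')
    · intro ζ
      obtain ⟨x, hx⟩ := hτsurj ((ζ : ℂ_[p]ˣ) : ℂ_[p]) ((mem_rootsOfUnity' _ _).mp ζ.2)
      have hx0 : x ≠ 0 := fun h => by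
        rw [h, map_zero] at hx
        exact (ζ : ℂ_[p]ˣ).ne_zero hx.symm
      refine ⟨Units.mk0 x hx0, Subtype.ext (Units.ext ?_)⟩
      rw [he₀, Units.val_mk0]
      exact hx
  -- reindex the sum over `μ^{n+1}` as a sum over `(𝔽^×)^{n+1}`
  have hsum : ∑ y : Option σ → rootsOfUnity (Nat.card k ^ s - 1) ℂ_[p],
      ∏ l ∈ Finset.range s, evalAt p G (fun i => ((y i : ℂ_[p]ˣ) : ℂ_[p]) ^ (Nat.card k ^ l)) =
      ∑ x : Option σ → (fixedField k s)ˣ, ψ (((x none : (fixedField k s)ˣ) : fixedField k s) *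
        MvPolynomial.aeval (fun j => ((x (some j) : (fixedField k s)ˣ) : fixedField k s)) f) := by
    refine (Fintype.sum_equiv (Equiv.piCongrRight fun _ : Option σ => Equiv.ofBijective e₀ hbij)
      _ _ fun x => ?_).symm
    have hx := hid (fun i => ((x i : (fixedField k s)ˣ) : fixedField k s)) fun i => (x i).ne_zero
    beta_reduce at hx
    rw [← hx]
    -- both sides agree definitionally: `↑(e₀ (x i)) = τ (x i)` by construction
    exact Finset.prod_congr rfl fun l _ => rfl
  have hN0 : ((Nat.card k ^ s - 1 : ℕ) : ℂ_[p]) ≠ 0 := by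
    exact_mod_cast (NeZero.ne (Nat.card k ^ s - 1))
  rw [traceNumber, finsum_eq_sum_of_fintype, Fintype.card_option, ← mul_assoc,
    mul_inv_cancel₀ (pow_ne_zero _ hN0), one_mul, hsum, sum_character_eq f s ψ hψ,
    add_sub_cancel]

end Counting

end Dwork

end Literature.NumberTheory.LFunctions
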